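import Summits.BirchSwinnertonDyer.BirchSwinnertonDyer.Theorems.AdditiveKolyvaginRoadManinFrameResidueProperRTameTwistFull57FourLe
import Summits.BirchSwinnertonDyer.BirchSwinnertonDyer.Theorems.AdditiveKolyvaginRoadIstarIsogenyInvariance
import Summits.BirchSwinnertonDyer.Rank1Residual.AdditivePotMult.PStarTwistModel
import HarnessLib

/-!
# Route `AdditiveKolyvaginRoad`, crux `ManinFrameResidueProperR` (stmt-BirchSwinnertonDyer-20709), line
# `tame-twist`, stub S57 (`p ∈ {5, 7}`): the «potentially good» hypothesis `0 ≤ v_p(j)` is DISCHARGED by the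
# crux's own «no `Iₙ*` member» clause — `--supports`, helper

Cell `pub/bsd-wall`, seat `bsd-wall-manin-p1` g5. THEOREMS ONLY (no definition, no named fact, no `sorry`);
nothing is closed. The member theorems of line `tame-twist` at `p ∈ {5, 7}`
(`stub_memberManinUnit_fiveSeven_of_kato57_of_kodaira`, `…_of_four_le`; files `…RTameTwistFull57`,
`…RTameTwistFull57FourLe`, seat g4) carry, besides the Kato–Kosters–Pannekoek fact `hK` and the crux binder
Dokchitser–Dokchitser `hDD`, the curve-level hypothesis `hj : 0 ≤ v_p(j(W))` (the frame curve is potentially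
good at `p`). Here `hj` is REMOVED: it follows from the residue clause of the crux itself,
«some globally minimal `W′ ∼ W` has Kodaira symbol `≠ Iₙ*` (every `n ≥ 0`) at the place over `p`», together
with `Addv W p`:

* `exists_kodairaSymbolAt_eq_Istar_of_addv_of_padicValRat_j_neg` — **additive and potentially
  multiplicative at an odd `p` ⟹ Kodaira type `Iₙ*`** at the place of `ℤ` over `p` (any equation `W`):
  `W ≅ V^{(p*)}` with `V` globally minimal and MULTIPLICATIVE at `p`
  (`AdditivePotMult.PotMult.exists_mult_pStar_twist_model`, Silverman *ATAEC* V.5.3), and the twist of a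
  `p`-semistable curve by `p* = (−1)^{(p−1)/2} p` (exactly divisible by `p`) has type `Iₙ*`
  (`Additive.kodairaSymbolAt_twist_of_semistable`, Tate's algorithm Steps 6–7).
* `padicValRat_j_nonneg_of_addv_of_forall_kodairaSymbolAt_ne_Istar` — contrapositive: additive at odd `p`
  with symbol `∉ {Iₙ*}` ⟹ `0 ≤ v_p(j)` (potentially good; Silverman *AEC* VII.5.5).
* `padicValRat_j_nonneg_of_addv_of_exists_member` — the same from the crux's class-shaped clause (the
  «not `Iₙ*`» property moves along `ℚ`-isogenies WITHOUT Dokchitser–Dokchitser: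
  `IstarIsogenyInvariance.forall_kodairaSymbolAt_ne_Istar_of_isIsogenous`, seat akr-p2).
* `forall_member_noPTorsion_of_kodaira_of_exists_member`, `exists_member_not_dvd_c_of_tameTwist57_offKP`,
  `stub_memberManinUnit_fiveSeven_of_kato57_offKP` — g4's theorems with `hj` discharged: **the registered
  stub S57, binder list VERBATIM, holds GRANTED `hK` (the `p ≥ 5` Kato–Kosters–Pannekoek Literature fact,
  statement-only) and `hDD` (Dokchitser–Dokchitser 2015 Thm. 5.1 (1) = the crux binder
  `DokchitserIsogenyMinimalDiscriminant`) at every frame OFF the Kosters–Pannekoek locus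
  `(p = 5 ∧ v₅(Δ_min W) ∈ {2, 3}) ∨ (p = 7 ∧ v₇(Δ_min W) = 2)`** (Kodaira II/III at `5`, II at `7`).

So after this file the open content of S57 is EXACTLY the Kosters–Pannekoek sub-residue (frames of type
II/III at `p = 5`, II at `p = 7`, on which some member may have a `ℚ_p`-rational point of order `p`; census
KP57-CENSUS-v1: 49 of 1 159 residue cells with `N ≤ 5·10⁵`, all of them covered by Cremona's `c₀ = 1`), plus
the formalisation of the Kato fact. BSD is not proved by any of this.

References: [SilvermanATAEC1994] IV.9.4 Steps 6–7, V.5.3; [SilvermanAEC2009] VII.5.4–5.5;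
[KostersPannekoek2017] Thm. 1, Cor. 2; [DokchitserDokchitser2015LocalInvariants] Thm. 5.1 (1);
[Mazur1977] III §5 Step 1.
-/

set_option autoImplicit false
set_option linter.dupNamespace false

noncomputable section

open scoped Classical NumberField

open WeierstrassCurve NumberField Literature.NumberTheory.EllipticCurves
  Literature.NumberTheory.EllipticCurves.ModularForms
  Literature.NumberTheory.EllipticCurves.Rank1Residual
  Literature.NumberTheory.DiophantineGeometry IsDedekindDomain Rat.HeightOneSpectrum
  Summit.BirchSwinnertonDyer.Rank1Residual Summit.BirchSwinnertonDyer.Rank1Residual.Additive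

namespace Summit.BirchSwinnertonDyer.BirchSwinnertonDyer.Theorems.ManinFrameResidueProperRTameTwist

section PotGood

variable {p : ℕ} [hp : Fact p.Prime]

/-- **Additive and potentially multiplicative at an odd prime ⟹ Kodaira type `Iₙ*`.** For an elliptic curve
`E/ℚ` (any equation `W`), an odd prime `p` at which `E` is additive with `v_p(j) < 0`, and the place `v` of
`ℤ` over `p`: `W.kodairaSymbolAt v = Iₙ*` for some `n`. Proof: `W = C • V^{(p*)}` with `V` globally minimal
and multiplicative at `p` (`PotMult.exists_mult_pStar_twist_model`; Silverman *ATAEC* V.5.3: `E` is the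
twist of a Tate curve by the ramified character, and `p*/d` is a unit square class), then Tate's algorithm
Steps 6–7 on the twist by the exact uniformiser multiple `p*` (`Additive.kodairaSymbolAt_twist_of_semistable`).
[cite: SilvermanATAEC1994, V.5.3 and IV.9.4 Steps 6–7 (PDF pp. 345–346)] -/
theorem exists_kodairaSymbolAt_eq_Istar_of_addv_of_padicValRat_j_neg
    (W : WeierstrassCurve ℚ) [W.IsElliptic] (hp2 : p ≠ 2) (hadd : Addv W p)
    (hj : padicValRat p W.j < 0) (v : HeightOneSpectrum ℤ) (hv : natGenerator v = p) :
    ∃ n : ℕ, W.kodairaSymbolAt v = .Istar n := by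
  have hpP : p.Prime := hp.out
  have hpm : Summit.BirchSwinnertonDyer.Rank1Residual.AdditivePotMult.PotMult W p := ⟨hadd, hj⟩
  obtain ⟨V, hVE, hVM, C, hmV, hC⟩ := hpm.exists_mult_pStar_twist_model hp2
  -- the place of `𝓞 ℚ` over `p`
  set v' : HeightOneSpectrum (𝓞 ℚ) := (primesEquiv (R := 𝓞 ℚ)).symm (primesEquiv v) with hv'def
  have hvv' : primesEquiv v = primesEquiv v' := ((primesEquiv (R := 𝓞 ℚ)).apply_symm_apply _).symm
  have hpeq : (primesEquiv v' : ℕ) = p := by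
    rw [← hvv']; exact hv
  have hv2 : (primesEquiv v' : ℕ) ≠ 2 := by rw [hpeq]; exact hp2
  -- `V` is multiplicative at `v'`
  have hV : V.HasGoodReductionAt v' ∨ V.HasMultiplicativeReductionAt v' := by
    right
    have hprimes : primesEquiv v' = ⟨p, hpP⟩ := Subtype.ext hpeq
    have hm : (haveI := Fact.mk (primesEquiv v').2;
        V.HasMultiplicativeReductionAtPrime (primesEquiv v' : ℕ)) := by
      rw [hprimes]; exact hmV
    exact (V.hasMultiplicativeReductionAtPrime_iff_hasMultiplicativeReductionAt_ringOfIntegers v').mp hm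
  -- `p*` is exactly divisible by `p`
  obtain ⟨hd0, h1, h2⟩ := IstarIsogenyInvariance.pStar_dvd_facts hpP
  have h1' : ((primesEquiv v' : ℕ) : ℤ) ∣ (-1 : ℤ) ^ (p / 2) * p := by rw [hpeq]; exact h1
  have h2' : ¬ ((primesEquiv v' : ℕ) : ℤ) ^ 2 ∣ (-1 : ℤ) ^ (p / 2) * p := by rw [hpeq]; exact h2
  have hC' : C • V.quadraticTwist ((((-1 : ℤ) ^ (p / 2) * p : ℤ)) : ℚ) = W := by
    push_cast; exact hC
  obtain ⟨n, hn⟩ := Additive.kodairaSymbolAt_twist_of_semistable v' V hv2 hd0 h1' h2' hV C hC'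
  exact ⟨n, by rw [O5.FlexNormalForm.kodairaSymbolAt_eq_of_primesEquiv_eq' W v v' hvv']; exact hn⟩

/-- **Additive at an odd prime with Kodaira symbol `∉ {Iₙ*}` ⟹ potentially good** (`0 ≤ v_p(j)`): the
contrapositive of `exists_kodairaSymbolAt_eq_Istar_of_addv_of_padicValRat_j_neg` (the additive types other than
`Iₙ*`, `n ≥ 0`, are II, III, IV, IV*, III*, II*, all with `v(j) ≥ 0`; Silverman *AEC* VII.5.5, *ATAEC*
Table 4.1). [cite: SilvermanATAEC1994, V.5.3 and IV.9.4 Steps 6–7] [cite: SilvermanAEC2009, VII.5 Prop. 5.5] -/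
theorem padicValRat_j_nonneg_of_addv_of_forall_kodairaSymbolAt_ne_Istar
    (W : WeierstrassCurve ℚ) [W.IsElliptic] (hp2 : p ≠ 2) (hadd : Addv W p)
    (v : HeightOneSpectrum ℤ) (hv : natGenerator v = p) (hK : ∀ n : ℕ, W.kodairaSymbolAt v ≠ .Istar n) :
    0 ≤ padicValRat p W.j := by
  by_contra hj
  obtain ⟨n, hn⟩ := exists_kodairaSymbolAt_eq_Istar_of_addv_of_padicValRat_j_neg W hp2 hadd (not_le.mp hj) v hv
  exact hK n hn

/-- **The frame curve of a residue frame is potentially good at `p`.** For `E/ℚ` (any equation `W`) additive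
at an odd prime `p` such that SOME `W′ ∼ W` has Kodaira symbol `≠ Iₙ*` (all `n`) at every place of `ℤ` with
generator `p` — the «no `Iₙ*` member» clause of the crux `ManinFrameResidueProperR` —: `0 ≤ v_p(j(W))`. The
clause moves from `W′` to `W` along the `ℚ`-isogeny without any Dokchitser–Dokchitser input
(`IstarIsogenyInvariance.forall_kodairaSymbolAt_ne_Istar_of_isIsogenous`).
[cite: SilvermanATAEC1994, V.5.3 and IV.9.4 Steps 6–7] [cite: SilvermanAEC2009, VII.5 Prop. 5.5] -/
theorem padicValRat_j_nonneg_of_addv_of_exists_member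
    (W : WeierstrassCurve ℚ) [W.IsElliptic] (hp2 : p ≠ 2) (hadd : Addv W p)
    (hres : ∃ (W' : WeierstrassCurve ℚ) (_ : W'.IsElliptic) (_ : W'.IsGloballyMinimal),
      IsIsogenous W W' ∧ ∀ (v : HeightOneSpectrum ℤ) (n : ℕ), natGenerator v = p →
        W'.kodairaSymbolAt v ≠ KodairaSymbol.Istar n) :
    0 ≤ padicValRat p W.j := by
  have hpP : p.Prime := hp.out
  obtain ⟨W', hE', _, hiso, hK'⟩ := hres
  set v₀ : HeightOneSpectrum ℤ := (primesEquiv (R := ℤ)).symm ⟨p, hpP⟩ with hv₀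
  have hv : natGenerator v₀ = p :=
    congrArg Subtype.val ((primesEquiv (R := ℤ)).apply_symm_apply ⟨p, hpP⟩)
  have hKW : ∀ n : ℕ, W.kodairaSymbolAt v₀ ≠ .Istar n := fun n ↦
    IstarIsogenyInvariance.forall_kodairaSymbolAt_ne_Istar_of_isIsogenous hiso.symm_of_charZero hp2 v₀ hv
      (fun m ↦ hK' v₀ m hv) v₀ n hv
  exact padicValRat_j_nonneg_of_addv_of_forall_kodairaSymbolAt_ne_Istar W hp2 hadd v₀ hv hKW

/-- **No member has a `ℚ_p`-rational point of order `p` — sharp Kodaira form, «potentially good» read off the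
residue clause.** For `W/ℚ` globally minimal, additive at `p ≥ 5`, `E[p]` irreducible, with some `W′ ∼ W` of
Kodaira symbol `∉ {Iₙ*}` at `p`, and `¬ ((p = 5 ∧ v_p(Δ_min(W)) ∈ {2, 3}) ∨ (p = 7 ∧ v_p(Δ_min(W)) = 2))`,
GRANTED Dokchitser–Dokchitser: every globally minimal `W″ ∼ W` has `W″(ℚ_p)[p] = 0`
(`forall_member_noPTorsion_of_kodaira` with `hj` from `padicValRat_j_nonneg_of_addv_of_exists_member`).
[cite: DokchitserDokchitser2015LocalInvariants, Thm. 5.1 (1)] [cite: Mazur1977, Ch. III §5, Step 1, p. 158] -/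
theorem forall_member_noPTorsion_of_kodaira_of_exists_member
    (hDD : dokchitser_padicValInt_minimalDiscriminantInt_eq_of_isogeny_of_not_dvd_degree)
    (W : WeierstrassCurve ℚ) [W.IsElliptic] [W.IsGloballyMinimal] (hp5 : 5 ≤ p) (hadd : Addv W p)
    (hirr : Irr W p)
    (hres : ∃ (W' : WeierstrassCurve ℚ) (_ : W'.IsElliptic) (_ : W'.IsGloballyMinimal),
      IsIsogenous W W' ∧ ∀ (v : HeightOneSpectrum ℤ) (n : ℕ), natGenerator v = p →
        W'.kodairaSymbolAt v ≠ KodairaSymbol.Istar n)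
    (hexc : ¬ ((p = 5 ∧ (padicValInt p W.minimalDiscriminantInt = 2 ∨
        padicValInt p W.minimalDiscriminantInt = 3)) ∨ (p = 7 ∧ padicValInt p W.minimalDiscriminantInt = 2)))
    (W' : WeierstrassCurve ℚ) [W'.IsElliptic] [W'.IsGloballyMinimal] (hiso : IsIsogenous W W')
    (P : (W'.baseChange ℚ_[p]).toAffine.Point) (hP : p • P = 0) : P = 0 :=
  forall_member_noPTorsion_of_kodaira hDD W hp5 hadd hirr
    (padicValRat_j_nonneg_of_addv_of_exists_member W (by omega) hadd hres) hexc W' hiso P hP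

/-- **At an AKR residue frame with `p ∈ {5, 7}`, OFF Kodaira II/III at `5` and II at `7`: a member with a
Manin-unit conductor-level datum**, GRANTED `hK` (Kato–Kosters–Pannekoek, `p ≥ 5` form) and `hDD`
(Dokchitser–Dokchitser); the «potentially good» hypothesis of `exists_member_not_dvd_c_of_tameTwist57_of_kodaira`
is read off the residue clause. [cite: KostersPannekoek2017, Thm. 1 and Cor. 2]
[cite: DokchitserDokchitser2015LocalInvariants, Thm. 5.1 (1)] -/
theorem exists_member_not_dvd_c_of_tameTwist57_offKP
    (hK : kato_neron_isIntegral_twistedSymbolSum_of_additive_five_le)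
    (hDD : dokchitser_padicValInt_minimalDiscriminantInt_eq_of_isogeny_of_not_dvd_degree)
    (hnf : exists_isNewformOf) (W : WeierstrassCurve ℚ) [W.IsElliptic] [W.IsGloballyMinimal]
    [NeZero (W.conductorNorm ℤ)] (hp57 : p = 5 ∨ p = 7) (hadd : Addv W p) (hirr : Irr W p)
    (hres : ∃ (W' : WeierstrassCurve ℚ) (_ : W'.IsElliptic) (_ : W'.IsGloballyMinimal),
      IsIsogenous W W' ∧ ∀ (v : HeightOneSpectrum ℤ) (n : ℕ), natGenerator v = p →
        W'.kodairaSymbolAt v ≠ KodairaSymbol.Istar n)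
    (hexc : ¬ ((p = 5 ∧ (padicValInt p W.minimalDiscriminantInt = 2 ∨
        padicValInt p W.minimalDiscriminantInt = 3)) ∨ (p = 7 ∧ padicValInt p W.minimalDiscriminantInt = 2))) :
    ∃ (W₀ : WeierstrassCurve ℚ) (_ : W₀.IsElliptic) (_ : W₀.IsGloballyMinimal)
      (D₀ : ModularParametrizationData W₀ (W.conductorNorm ℤ)),
      IsIsogenous W W₀ ∧ ¬ (p : ℤ) ∣ D₀.c := by
  have hp2 : p ≠ 2 := by rcases hp57 with rfl | rfl <;> norm_num
  exact exists_member_not_dvd_c_of_tameTwist57_of_kodaira hK hDD hnf W hp57 hadd hirr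
    (padicValRat_j_nonneg_of_addv_of_exists_member W hp2 hadd hres) hexc

/-- **The registered stub S57 of line `tame-twist` (crux `ManinFrameResidueProperR`), binder list VERBATIM,
OFF the Kosters–Pannekoek locus — GRANTED only `hK` and `hDD`.** Compared with g4's
`stub_memberManinUnit_fiveSeven_of_kato57_of_kodaira` the hypothesis `hj : 0 ≤ v_p(j(W))` is GONE: it is
supplied by the stub's own binder `hres` (second conjunct: a member with no `Iₙ*` fibre at `p`) through
`padicValRat_j_nonneg_of_addv_of_exists_member`. Here `hK` is the statement-only Literature fact
`kato_neron_isIntegral_twistedSymbolSum_of_additive_five_le` (Kato 2004 (8.1.3)/9.7/6.6 + Kim–Nakamura §2 ⟸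
Kosters–Pannekoek; XL to formalise) and `hDD` is Dokchitser–Dokchitser 2015 Thm. 5.1 (1), the binder
`DokchitserIsogenyMinimalDiscriminant` of the crux itself. WHAT REMAINS of S57: the frames with
`(p = 5 ∧ v₅(Δ_min W) ∈ {2,3}) ∨ (p = 7 ∧ v₇(Δ_min W) = 2)` (Kodaira II/III at `5`, II at `7`), where a member
may carry a `ℚ_p`-rational point of order `p` and Kato's bound only gives `v_p(c) ≤ 1`. Nothing is closed;
BSD is not proved by any of this. [cite: KostersPannekoek2017, Thm. 1 and Cor. 2]
[cite: DokchitserDokchitser2015LocalInvariants, Thm. 5.1 (1)] [cite: SilvermanATAEC1994, V.5.3] -/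
theorem stub_memberManinUnit_fiveSeven_of_kato57_offKP
    (hK : kato_neron_isIntegral_twistedSymbolSum_of_additive_five_le)
    (hDD : dokchitser_padicValInt_minimalDiscriminantInt_eq_of_isogeny_of_not_dvd_degree)
    (hnf : Literature.NumberTheory.EllipticCurves.ModularForms.exists_isNewformOf)
    (W : WeierstrassCurve ℚ) [W.IsElliptic] [W.IsGloballyMinimal] (hp5 : 5 ≤ p) (hp11 : p < 11)
    [NeZero (W.conductorNorm ℤ)] (hadd : Addv W p) (hirr : Irr W p)
    (hres : ((p < 11 ∨ ∃ (W' : WeierstrassCurve ℚ) (_ : W'.IsElliptic) (_ : W'.IsGloballyMinimal),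
          IsIsogenous W W' ∧ TypeGOrd W' p ∧ padicValInt p W'.minimalDiscriminantInt ≤ 4) ∧
        (∃ (W' : WeierstrassCurve ℚ) (_ : W'.IsElliptic) (_ : W'.IsGloballyMinimal),
          IsIsogenous W W' ∧ ∀ (v : HeightOneSpectrum ℤ) (n : ℕ), natGenerator v = p →
            W'.kodairaSymbolAt v ≠ KodairaSymbol.Istar n)))
    (_hall : (∀ (W' : WeierstrassCurve ℚ) [W'.IsElliptic] [W'.IsGloballyMinimal]
          (D' : ModularParametrizationData W' (W.conductorNorm ℤ)),
          IsIsogenous W W' → p ∣ D'.modularDegree))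
    (hexc : ¬ ((p = 5 ∧ (padicValInt p W.minimalDiscriminantInt = 2 ∨
        padicValInt p W.minimalDiscriminantInt = 3)) ∨ (p = 7 ∧ padicValInt p W.minimalDiscriminantInt = 2))) :
    ∃ (W₀ : WeierstrassCurve ℚ) (_ : W₀.IsElliptic) (_ : W₀.IsGloballyMinimal)
        (D₀ : ModularParametrizationData W₀ (W.conductorNorm ℤ)),
        IsIsogenous W W₀ ∧ ¬ (p : ℤ) ∣ D₀.c := by
  have hpP : p.Prime := hp.out
  have hp57 : p = 5 ∨ p = 7 := by
    interval_cases p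
    · exact Or.inl rfl
    · exact absurd hpP (by decide)
    · exact Or.inr rfl
    · exact absurd hpP (by decide)
    · exact absurd hpP (by decide)
    · exact absurd hpP (by decide)
  exact exists_member_not_dvd_c_of_tameTwist57_offKP hK hDD hnf W hp57 hadd hirr hres.2 hexc

end PotGood

end Summit.BirchSwinnertonDyer.BirchSwinnertonDyer.Theorems.ManinFrameResidueProperRTameTwist

end
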